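import Mathlib
import Literature.Analysis.FluidPDE.TorusNS2DGlobalExistence
import Literature.Analysis.FluidPDE.PassiveScalarWellPosednessProofs
import Literature.Analysis.FluidPDE.TwoHalfNavierStokes
import Literature.Analysis.FluidPDE.ClassicalSolutionTorusProofs
import Literature.Analysis.FluidPDE.AxisymmetricEuler
import HarnessLib

/-!
# Crux `ColumnarCoreExclusion` (stmt-NavierStokesRegularity-1966), line `columnar_comparison_flow`:
# the 2½-dimensional LAUNCH — global classical columnar Navier–Stokes flows on `UnitAddTorus (Fin 3)` and on `ℝ³` from planar data

`--supports stmt-NavierStokesRegularity-1966` (helper file; theorems only, no definitions, no `sorry`).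

The "launch block" of `stub_columnarComparisonFlow`, assembled from tree parts:
* two-dimensional global regularity on `UnitAddTorus (Fin 2)` (`Torus.exists_classicalNS_forced_fin_two_Icc`, Ladyzhenskaya 1959) for the
  horizontal velocity `V`;
* classical well-posedness of the advection–diffusion equation on `UnitAddTorus (Fin 2)` with the smooth divergence-free drift `V`
  (`Torus.exists_unique_isClassicalScalarTransportForcedOn_holds`, via the unforced corollary) for the vertical velocity `R`;
* the `2½`-dimensional packaging theorem `Torus.isClassicalNSSolutionOn_twoHalf` (Majda–Bertozzi §2.3.1): `(V, R) ∘ π`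
  solves Navier–Stokes on `UnitAddTorus (Fin 3)` with force = the planar residuals, which VANISH here;
* the torus-to-space bridge `IsClassicalNSSolutionOn.of_torus_holds`: the periodic lift is a classical solution on `ℝ³`,
  invariant under all vertical translations, bounded on the compact time window.
Nothing here says anything about Navier–Stokes regularity in three dimensions.
-/

noncomputable section

open Set Metric MeasureTheory Function
open Literature.Analysis Literature.Analysis.FunctionSpaces Literature.Analysis.FluidPDE
open Literature.Analysis.FunctionSpaces.Torus (twoHalf planarProj planarProjE planarEmbed twoHalf_apply_two
  twoHalf_apply_castSucc lift proj)
open scoped InnerProductSpace ContDiff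

namespace Summit.NavierStokesRegularity.NavierStokesRegularity.Theorems

-- the problem directory repeats the summit name (`NavierStokesRegularity/NavierStokesRegularity`)
set_option linter.dupNamespace false

namespace ColumnarComparisonLaunch

/-- **2½-dimensional global classical flows on `UnitAddTorus (Fin 3)`.**  For `ν > 0`, `τ > 0`, smooth planar data `V₀ : UnitAddTorus (Fin 2) → ℝ²`
(divergence free) and `R₀ : UnitAddTorus (Fin 2) → ℝ` there are a global classical solution `V` (pressure `φ`) of the two-dimensional
Navier–Stokes equations on `[0, τ] × UnitAddTorus (Fin 2)` with `V 0 = V₀` (Ladyzhenskaya) and a classical solution `R` of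
`∂ₜR + V·∇R = νΔR` with `R 0 = R₀` (parabolic well-posedness), and the columnar field `u = (V, R) ∘ π` with pressure
`φ ∘ π` is a classical solution of the UNFORCED Navier–Stokes system on `[0, τ] × UnitAddTorus (Fin 3)`, bounded there.
[cite: MajdaBertozziCUP2002, §2.3.1 Prop 2.7] -/
theorem exists_twoHalf_classicalNS {ν τ : ℝ} (hν : 0 < ν) (hτ : 0 < τ)
    {V₀ : UnitAddTorus (Fin 2) → EuclideanSpace ℝ (Fin 2)} {R₀ : UnitAddTorus (Fin 2) → ℝ}
    (hV₀ : Torus.IsSmooth V₀) (hV₀div : Torus.IsDivFree V₀) (hR₀ : Torus.IsSmooth R₀) :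
    ∃ (V : ℝ → UnitAddTorus (Fin 2) → EuclideanSpace ℝ (Fin 2)) (R φ : ℝ → UnitAddTorus (Fin 2) → ℝ),
      Torus.IsClassicalNSSolutionOn (Icc 0 τ) ν 0 (fun s => twoHalf (V s) (R s)) (fun s => φ s ∘ planarProj) ∧
      V 0 = V₀ ∧ R 0 = R₀ ∧
      ∃ M : ℝ, ∀ s ∈ Icc 0 τ, ∀ x, ‖twoHalf (V s) (R s) x‖ ≤ M := by
  -- (1) two-dimensional Navier–Stokes from `V₀`, zero force (potential `ū = 0`)
  have h0s : Torus.IsSmooth (0 : UnitAddTorus (Fin 2) → EuclideanSpace ℝ (Fin 2)) := Torus.isSmooth_const (0 : EuclideanSpace ℝ (Fin 2))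
  have h0st : Torus.IsSmoothSpaceTimeOn (Icc 0 τ) (0 : ℝ → UnitAddTorus (Fin 2) → EuclideanSpace ℝ (Fin 2)) :=
    Torus.isSmoothSpaceTimeOn_const h0s _
  have h0div : ∀ t ∈ Icc 0 τ, Torus.IsDivFree ((0 : ℝ → UnitAddTorus (Fin 2) → EuclideanSpace ℝ (Fin 2)) t) := fun t _ x => by
    simp [Torus.divergence, Torus.partialDeriv, Torus.lineDeriv]
  have h0f : ∀ t ∈ Icc 0 τ, ∀ x, Torus.timeDerivWithin (Icc 0 τ) (0 : ℝ → UnitAddTorus (Fin 2) → EuclideanSpace ℝ (Fin 2)) t x =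
      (0 : ℝ → UnitAddTorus (Fin 2) → EuclideanSpace ℝ (Fin 2)) t x := fun t _ x => by
    simp [Torus.timeDerivWithin]
  obtain ⟨V, φ, hV, hV0⟩ :=
    FluidPDE.Torus.exists_classicalNS_forced_fin_two_Icc hν hτ h0st h0div h0f hV₀ hV₀div
  -- (2) the vertical component: classical advection–diffusion along `V`
  obtain ⟨R, hR, hR0, -⟩ :=
    FluidPDE.Torus.exists_unique_isClassicalScalarTransportOn_of_forced
      FluidPDE.Torus.exists_unique_isClassicalScalarTransportForcedOn_holds hν hτ hV.smooth_velocity hV.divFree hR₀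
  -- (3) the 2½-dimensional packaging; the force is the pair of residuals, both zero
  have hU := FluidPDE.Torus.isClassicalNSSolutionOn_twoHalf (uniqueDiffOn_Icc hτ) ν hV.smooth_velocity
    hR.smooth_scalar hV.smooth_pressure hV.divFree
  have hforce : ∀ s ∈ Icc 0 τ, ∀ x, FluidPDE.Torus.twoHalfForce (Icc 0 τ) ν V R φ s x = 0 := by
    intro s hs x
    rw [FluidPDE.Torus.twoHalfForce_apply]
    have h1 : (fun y => Torus.timeDerivWithin (Icc 0 τ) V s y + Torus.convect (V s) (V s) y -
        ν • Torus.laplacian (V s) y + Torus.gradient (φ s) y) = 0 := by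
      funext y
      have hm := hV.momentum s hs y
      simp only [Pi.zero_apply, add_zero] at hm
      rw [hm]; simp
    have h2 : (fun y => Torus.timeDerivWithin (Icc 0 τ) R s y + ⟪V s y, Torus.gradient (R s) y⟫_ℝ -
        ν * Torus.laplacian (R s) y) = 0 := by
      funext y
      have ht := hR.transport s hs y
      rw [ht]; simp
    rw [h1, h2, Torus.twoHalf_zero]; rfl
  refine ⟨V, R, φ, ⟨hU.smooth_velocity, hU.smooth_pressure, fun s hs x => ?_, hU.divFree⟩, hV0, hR0, ?_⟩
  · have hm := hU.momentum s hs x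
    rw [hforce s hs x] at hm
    simpa using hm
  · exact (hV.smooth_velocity.twoHalf hR.smooth_scalar).exists_norm_le_of_isCompact isCompact_Icc subset_rfl

/-- Vertical translations do not change the planar projection of a point of `ℝ³` read on `UnitAddTorus (Fin 3)`:
`π (proj (y + a e_z)) = π (proj y)`. [folklore] -/
theorem planarProj_proj_add_smul_eZ (y : EuclideanSpace ℝ (Fin 3)) (a : ℝ) :
    planarProj (proj (y + a • eZ)) = planarProj (proj y) := by
  rw [Torus.planarProj_proj, Torus.planarProj_proj, map_add, map_smul]
  have : planarProjE eZ = 0 := by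
    ext i
    rw [Torus.planarProjE_apply]
    fin_cases i <;> simp [eZ]
  rw [this, smul_zero, add_zero]

/-- **2½-dimensional global classical flows on `ℝ³` (periodic lift).**  For `ν > 0`, `τ > 0` and smooth planar torus
data `V₀` (divergence free), `R₀`, there is a classical solution `(u, p)` of the UNFORCED Navier–Stokes system on
`[0, τ] × ℝ³` which is COLUMNAR (`u s (y + a • e_z) = u s y`), bounded on `[0, τ] × ℝ³`, and whose initial slice is
the lift of `(V₀, R₀) ∘ π`: `u 0 y = twoHalf V₀ R₀ (proj y)`. [cite: MajdaBertozziCUP2002, §2.3.1 Prop 2.7] -/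
theorem exists_columnar_classicalNS_lift {ν τ : ℝ} (hν : 0 < ν) (hτ : 0 < τ)
    {V₀ : UnitAddTorus (Fin 2) → EuclideanSpace ℝ (Fin 2)} {R₀ : UnitAddTorus (Fin 2) → ℝ}
    (hV₀ : Torus.IsSmooth V₀) (hV₀div : Torus.IsDivFree V₀) (hR₀ : Torus.IsSmooth R₀) :
    ∃ (u : ℝ → EuclideanSpace ℝ (Fin 3) → EuclideanSpace ℝ (Fin 3)) (p : ℝ → EuclideanSpace ℝ (Fin 3) → ℝ),
      IsClassicalNSSolutionOn (Icc 0 τ) ν 0 u p ∧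
      (∀ (s : ℝ) (y : EuclideanSpace ℝ (Fin 3)) (a : ℝ), u s (y + a • eZ) = u s y) ∧
      (∃ M : ℝ, ∀ s ∈ Icc 0 τ, ∀ y, ‖u s y‖ ≤ M) ∧
      (∀ y, u 0 y = twoHalf V₀ R₀ (proj y)) := by
  obtain ⟨V, R, φ, hU, hV0, hR0, M, hM⟩ := exists_twoHalf_classicalNS hν hτ hV₀ hV₀div hR₀
  have hlift := IsClassicalNSSolutionOn.of_torus_holds hU
  refine ⟨fun s => lift (twoHalf (V s) (R s)), fun s => lift (φ s ∘ planarProj), ?_, ?_, ⟨M, fun s hs y => ?_⟩, ?_⟩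
  · have e : (fun s => lift ((0 : ℝ → UnitAddTorus (Fin 3) → EuclideanSpace ℝ (Fin 3)) s)) = (0 : ℝ → EuclideanSpace ℝ (Fin 3) → EuclideanSpace ℝ (Fin 3)) := by
      funext s y; simp [Torus.lift_apply]
    rw [e] at hlift
    exact hlift
  · intro s y a
    simp only [Torus.lift_apply, Torus.twoHalf_eq_comp, Function.comp_apply, planarProj_proj_add_smul_eZ]
  · show ‖lift (twoHalf (V s) (R s)) y‖ ≤ M
    rw [Torus.lift_apply]; exact hM s hs _
  · intro y
    show lift (twoHalf (V 0) (R 0)) y = _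
    rw [Torus.lift_apply, hV0, hR0]

end ColumnarComparisonLaunch

end Summit.NavierStokesRegularity.NavierStokesRegularity.Theorems

end
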